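import Summits.CriticalPhenomena.CardyFormulaZ2.Theorems.CardyComplexConeParafermionToSLESixFamiliesDiamondIdentifyLoopEdges
import Mathlib.Topology.Algebra.Order.Floor
import HarnessLib

/-!
# Line `potential-darboux-picard-diamond`, stub S4′ (`stub_identifyPotentialPh`): the boundary loop of a marked diamond

Helper file of the stub `stub_identifyPotentialPh` of crux `ParafermionToSLESixFamilies` (stmt-CriticalPhenomena-11389).
Steps (iii)–(iv) of the identification (the closed left-turning boundary chain of the potential limit, and the boundary
correspondence of the Riemann map of the diamond) need an explicit counter-clockwise parametrisation of the frontier of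
a marked diamond. This file constructs it (`exists_boundaryLoop`, registered helper of the crux item): for
`IsMarkedDiamond D` there are corners `P k` (`4`-periodic) and a continuous `2π`-periodic loop `ℓ : ℝ → ℂ`, affine on
each quarter period (`ℓ ((k + r) π/2) = P k + r (P (k+1) − P k)`, `0 ≤ r ≤ 1`), injective on `[0, 2π)`, with range
EXACTLY `frontier D.carrier`; consecutive sides turn left by a right angle
(`(P (k+2) − P (k+1)) / (P (k+1) − P k) ∈ ℝ_{>0} · i`), and the (convex) carrier lies strictly to the left of every
directed side (`0 < im ((z − P k) conj (P (k+1) − P k))` for `z ∈ D.carrier`) and contains the centre `c`. Everything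
is computed in the tilted frame `e = exp(−iπ/4)` (per-edge computations in `…DiamondIdentifyLoopEdges`); the loop is
`F ∘ fract (·/2π)` for the piecewise-affine one-period map `F` through the corners (`ContinuousOn.comp_fract''`).
-/

noncomputable section

namespace Summit.CriticalPhenomena.CardyFormulaZ2.Cruxes.ParafermionToSLESixFamilies.PotentialDarbouxPicardDiamond

open scoped Topology ComplexConjugate
open Filter Set Metric Complex
open Literature.Probability.RandomPlanarGeometry

/-! ## The boundary loop -/

/-- **The boundary loop of a marked diamond.** -/
theorem exists_boundaryLoop : ∀ (D : DobrushinDomain), IsMarkedDiamond D → ∃ (ℓ : ℝ → ℂ) (P : ℕ → ℂ) (c : ℂ), c ∈ D.carrier ∧ Convex ℝ D.carrier ∧ Continuous ℓ ∧ (∀ s : ℝ, ℓ (s + 2 * Real.pi) = ℓ s) ∧ Set.range ℓ = frontier D.carrier ∧ Set.InjOn ℓ (Set.Ico 0 (2 * Real.pi)) ∧ (∀ k : ℕ, P (k + 4) = P k) ∧ (∀ k : ℕ, P k ≠ P (k + 1)) ∧ (∀ (k : ℕ) (r : ℝ), 0 ≤ r → r ≤ 1 → ℓ ((k + r) * (Real.pi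 / 2)) = P k + r * (P (k + 1) - P k)) ∧ (∀ k : ℕ, ∃ ρ : ℝ, 0 < ρ ∧ (P (k + 2) - P (k + 1)) / (P (k + 1) - P k) = ρ * I) ∧ (∀ z ∈ D.carrier, ∀ k : ℕ, 0 < ((z - P k) * (starRingEnd ℂ) (P (k + 1) - P k)).im) := by
  intro D hD
  obtain ⟨c, α, β, hα, hβ, hcar⟩ := hD
  set e : ℂ := exp (-(Real.pi / 4 : ℝ) * I) with hedef
  have he1 : ‖e‖ = 1 := norm_exp_neg_pi_div_four_mul_I
  have hπ := Real.pi_pos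
  obtain ⟨W, hWper, hW0, hW1, hW2, hW3⟩ := cornerOffset_spec α β
  -- the corners
  set P : ℕ → ℂ := fun k => c + conj e * W k with hP
  have hPper : ∀ k, P (k + 4) = P k := fun k => by simp only [hP]; rw [hWper]
  have hP4 : P 4 = P 0 := hPper 0
  -- the one-period map `F` on `[0, 1]` and the loop
  set F : ℝ → ℂ := fun r =>
    if r ≤ 1 / 4 then P 0 + ((4 * r : ℝ) : ℂ) * (P 1 - P 0)
    else if r ≤ 2 / 4 then P 1 + ((4 * r - 1 : ℝ) : ℂ) * (P 2 - P 1)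
    else if r ≤ 3 / 4 then P 2 + ((4 * r - 2 : ℝ) : ℂ) * (P 3 - P 2)
    else P 3 + ((4 * r - 3 : ℝ) : ℂ) * (P 4 - P 3) with hF
  have hFc : Continuous F := by
    simp only [hF]
    refine Continuous.if_le (by fun_prop) ?_ continuous_id continuous_const (fun r hr => ?_)
    · refine Continuous.if_le (by fun_prop) ?_ continuous_id continuous_const (fun r hr => ?_)
      · refine Continuous.if_le (by fun_prop) (by fun_prop) continuous_id continuous_const (fun r hr => ?_)
        rw [hr]; push_cast; ring
      · rw [hr, if_pos (by norm_num : (2 / 4 : ℝ) ≤ 3 / 4)]; push_cast; ring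
    · rw [hr, if_pos (by norm_num : (1 / 4 : ℝ) ≤ 2 / 4)]; push_cast; ring
  have hF01 : F 0 = F 1 := by
    simp only [hF]
    rw [if_pos (by norm_num : (0:ℝ) ≤ 1 / 4), if_neg (by norm_num : ¬ (1:ℝ) ≤ 1 / 4),
      if_neg (by norm_num : ¬ (1:ℝ) ≤ 2 / 4), if_neg (by norm_num : ¬ (1:ℝ) ≤ 3 / 4), hP4]
    push_cast; ring
  set ℓ : ℝ → ℂ := fun s => F (Int.fract (s / (2 * Real.pi))) with hℓ
  have hℓc : Continuous ℓ := (hFc.continuousOn.comp_fract'' hF01).comp (continuous_id.div_const _)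
  have hℓper : ∀ s, ℓ (s + 2 * Real.pi) = ℓ s := fun s => by
    simp only [hℓ]; rw [add_div, div_self (by positivity), Int.fract_add_one]
  -- the piece formula on one period
  have hpiece0 : ∀ (k : ℕ) (r : ℝ), k < 4 → 0 ≤ r → r ≤ 1 →
      ℓ ((k + r) * (Real.pi / 2)) = P k + r * (P (k + 1) - P k) := by
    intro k r hk hr0 hr1
    simp only [hℓ]
    have hdiv : (k + r) * (Real.pi / 2) / (2 * Real.pi) = (k + r) / 4 := by field_simp; ring
    rw [hdiv]
    by_cases htop : (k : ℝ) + r = 4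
    · have hk3 : k = 3 := by
        have : (3 : ℝ) ≤ k := by linarith
        have : 3 ≤ k := by exact_mod_cast this
        omega
      subst hk3
      have hr : r = 1 := by push_cast at htop; linarith
      rw [htop, div_self (by norm_num), Int.fract_one, hr]
      show F 0 = _
      simp only [hF]; rw [if_pos (by norm_num : (0:ℝ) ≤ 1 / 4)]
      push_cast; rw [hP4]; ring
    have hk3 : (k : ℝ) ≤ 3 := by exact_mod_cast Nat.lt_succ_iff.1 hk
    have hlt : ((k : ℝ) + r) / 4 < 1 := by
      rw [div_lt_one (by norm_num)]; exact lt_of_le_of_ne (by linarith) htop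
    rw [Int.fract_eq_self.2 ⟨by positivity, hlt⟩]
    simp only [hF]
    interval_cases k
    · rw [if_pos (by push_cast; linarith)]; push_cast; ring
    · by_cases h0 : r = 0
      · subst h0; rw [if_pos (by norm_num)]; push_cast; ring
      · have hr0' : 0 < r := lt_of_le_of_ne hr0 (Ne.symm h0)
        rw [if_neg (by push_cast; linarith), if_pos (by push_cast; linarith)]; push_cast; ring
    · by_cases h0 : r = 0
      · subst h0; rw [if_neg (by norm_num), if_pos (by norm_num)]; push_cast; ring
      · have hr0' : 0 < r := lt_of_le_of_ne hr0 (Ne.symm h0)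
        rw [if_neg (by push_cast; linarith), if_neg (by push_cast; linarith), if_pos (by push_cast; linarith)]
        push_cast; ring
    · by_cases h0 : r = 0
      · subst h0; rw [if_neg (by norm_num), if_neg (by norm_num), if_pos (by norm_num)]; push_cast; ring
      · have hr0' : 0 < r := lt_of_le_of_ne hr0 (Ne.symm h0)
        rw [if_neg (by push_cast; linarith), if_neg (by push_cast; linarith), if_neg (by push_cast; linarith)]
        push_cast; ring
  -- the piece formula for all `k`
  have hperN : ∀ (n : ℕ) (s : ℝ), ℓ (s + n * (2 * Real.pi)) = ℓ s := by
    intro n s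
    induction n with
    | zero => simp
    | succ n ih => rw [show s + ((n + 1 : ℕ) : ℝ) * (2 * Real.pi) = (s + n * (2 * Real.pi)) + 2 * Real.pi by
        push_cast; ring, hℓper, ih]
  have hpiece : ∀ (k : ℕ) (r : ℝ), 0 ≤ r → r ≤ 1 → ℓ ((k + r) * (Real.pi / 2)) = P k + r * (P (k + 1) - P k) := by
    intro k r hr0 hr1
    have hPk : P k = P (k % 4) := by simp only [hP]; rw [← periodic4_mod hWper]
    have hPk1 : P (k + 1) = P (k % 4 + 1) := by
      have : (k + 1) % 4 = (k % 4 + 1) % 4 := by omega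
      simp only [hP]; rw [periodic4_mod hWper (k + 1), periodic4_mod hWper (k % 4 + 1), this]
    have hs : ((k : ℝ) + r) * (Real.pi / 2) = ((k % 4 : ℕ) + r) * (Real.pi / 2) + (k / 4 : ℕ) * (2 * Real.pi) := by
      have : (k : ℝ) = (k % 4 : ℕ) + 4 * (k / 4 : ℕ) := by exact_mod_cast (Nat.mod_add_div k 4).symm
      rw [this]; ring
    rw [hs, hperN, hpiece0 _ r (Nat.mod_lt _ (by norm_num)) hr0 hr1, ← hPk, ← hPk1]
  -- decomposition of a parameter of `[0, 2π)`
  have hdecomp : ∀ s ∈ Ico (0:ℝ) (2 * Real.pi), ∃ (k : ℕ) (r : ℝ), k < 4 ∧ 0 ≤ r ∧ r < 1 ∧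
      s = (k + r) * (Real.pi / 2) := by
    intro s hs
    set x : ℝ := s / (Real.pi / 2) with hx
    have hx0 : 0 ≤ x := div_nonneg hs.1 (by positivity)
    have hx4 : x < 4 := by rw [hx, div_lt_iff₀ (by positivity)]; linarith [hs.2]
    refine ⟨⌊x⌋₊, x - ⌊x⌋₊, ?_, ?_, ?_, ?_⟩
    · have : (⌊x⌋₊ : ℝ) < 4 := lt_of_le_of_lt (Nat.floor_le hx0) hx4
      exact_mod_cast this
    · linarith [Nat.floor_le hx0]
    · linarith [Nat.lt_floor_add_one x]
    · rw [add_sub_cancel, hx]; field_simp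
  -- injectivity on one period
  have hinj : InjOn ℓ (Ico 0 (2 * Real.pi)) := by
    intro s hs s' hs' hss'
    obtain ⟨k, r, hk, hr0, hr1, rfl⟩ := hdecomp s hs
    obtain ⟨k', r', hk', hr0', hr1', rfl⟩ := hdecomp s' hs'
    rw [hpiece0 k r hk hr0 hr1.le, hpiece0 k' r' hk' hr0' hr1'.le] at hss'
    obtain ⟨rfl, rfl⟩ := edge_inj c e he1 hα hβ hWper hW0 hW1 hW2 hW3 hk hk' hr1 hr1' hss'
    rfl
  -- the range is the frontier
  have hrange : range ℓ = frontier D.carrier := by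
    apply Subset.antisymm
    · rintro _ ⟨s, rfl⟩
      have hs' : ℓ s = ℓ (Int.fract (s / (2 * Real.pi)) * (2 * Real.pi)) := by
        simp only [hℓ]; rw [mul_div_cancel_right₀ _ (by positivity), Int.fract_fract]
      rw [hs']
      have hmemI : Int.fract (s / (2 * Real.pi)) * (2 * Real.pi) ∈ Ico (0:ℝ) (2 * Real.pi) :=
        ⟨mul_nonneg (Int.fract_nonneg _) (by positivity),
          by nlinarith [Int.fract_lt_one (s / (2 * Real.pi)), Int.fract_nonneg (s / (2 * Real.pi))]⟩
      obtain ⟨k, r, hk, hr0, hr1, hkr⟩ := hdecomp _ hmemI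
      rw [hkr, hpiece0 k r hk hr0 hr1.le, hcar]
      exact edge_mem_frontier c e he1 hα hβ hWper hW0 hW1 hW2 hW3 k hr0 hr1.le
    · intro z hz
      rw [hcar] at hz
      obtain ⟨k, r, -, hr0, hr1, rfl⟩ := exists_edge_of_mem_frontier c e he1 hα hβ hWper hW0 hW1 hW2 hW3 hz
      exact ⟨(k + r) * (Real.pi / 2), hpiece k r hr0 hr1⟩
  -- turning, orientation, the centre
  have hc_mem : c ∈ D.carrier := by
    rw [hcar]; simp only [mem_setOf_eq, sub_self, zero_mul, zero_re, zero_im, abs_zero]; exact ⟨hα, hβ⟩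
  have hconv : Convex ℝ D.carrier := by rw [hcar]; exact convex_tiltedBox c e α β
  have hleft : ∀ z ∈ D.carrier, ∀ k : ℕ, 0 < ((z - P k) * conj (P (k + 1) - P k)).im := by
    intro z hz k
    have hzin : |((z - c) * e).re| < α ∧ |((z - c) * e).im| < β := by rw [hcar] at hz; exact hz
    exact (turn_and_left c e he1 hα hβ hWper hW0 hW1 hW2 hW3 k).2 z hzin.1 hzin.2
  have hPne : ∀ k, P k ≠ P (k + 1) := by
    intro k heq
    have := hleft c hc_mem k
    rw [← heq, sub_self, map_zero, mul_zero, zero_im] at this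
    exact lt_irrefl _ this
  exact ⟨ℓ, P, c, hc_mem, hconv, hℓc, hℓper, hrange, hinj, hPper, hPne, hpiece,
    fun k => (turn_and_left c e he1 hα hβ hWper hW0 hW1 hW2 hW3 k).1, hleft⟩

end Summit.CriticalPhenomena.CardyFormulaZ2.Cruxes.ParafermionToSLESixFamilies.PotentialDarbouxPicardDiamond

end
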